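import Literature.NumberTheory.Automorphic.UnitaryGroupKernelOffBorelVanishingTwo
import Literature.NumberTheory.Automorphic.UnitaryGroupRationalIsotropicLastRowTwo
import Literature.NumberTheory.Automorphic.UnitaryGroupMahlerRegion
import Literature.NumberTheory.Automorphic.UnitaryGroupEllipticCentralizerCompact
import Literature.MeasureTheory.Group.InvariantQuotientCompactFibre
import Literature.NumberTheory.Automorphic.LevelOrbitPushforward
import HarnessLib

/-!
# Elliptic centralisers in `U(J₂)` are cocompact and unimodular — by reduction theory
# (the `N = 2` twin of ★ `UnitaryGroupEllipticCentralizerCompact`)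
(Rogawski, *Automorphic Representations of Unitary Groups in Three Variables* (1990), §2.2–§2.3,
pp. 13–14, and p. 98 «Let `G = U(3)`, `U(2)`, or `U(2) × U(1)`»: one reduction theory for the three
rank-one groups; Arthur, Duke Math. J. 45 (1978), §8: for a class `𝔬` meeting no proper rational
parabolic the volumes `vol(G_γ(F)\G_γ(𝔸))` are finite; Gelfand–Graev–Piatetski-Shapiro (1969), Ch. 1 §2
(lattice lemma); Deitmar–Echterhoff (2014), Lemma 9.3.3 (unimodularity).)

Topic `NumberTheory/Automorphic`; namespace `Literature.NumberTheory.Automorphic.UnitaryGroup`. THEOREMS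
ONLY over accepted tree modules: no definition, no named fact, no `sorry`, no instance, no notation.
H-side copy of LAWS 1–5 for the endoscopic group `H = U(Φ₂) × U(Φ₁)` of the line
`Cruxes/H413/Lines/F0_T1InnerFormTraceIdentity.lean` (cell hodgecm-mathlib, crux H413; census
`CENSUS-LAWS-Hside` §3 LAW 4 «elliptic class terms are orbital integrals»): the accepted ★
`UnitaryGroupEllipticCentralizerCompact` is typed for `U(J₃)` (★ `quasiSplit F E c 3`); this file
re-types it for `U(J₂)` (★ `quasiSplit F E c 2`) with the proofs of the `N = 3` file verbatim — they are
rank-one generic once the two `N`-dependent inputs are supplied at `N = 2`: Godement's cut-off ★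
`exists_borelHeight_le_of_conj_mem_of_not_mem_arithmeticBorel_two` (★ `UnitaryGroupKernelOffBorelVanishingTwo`)
and Witt's theorem for the isotropic lines of the hyperbolic plane ★ `exists_rational_lastRow_eq_smul_two`
(★ `UnitaryGroupRationalIsotropicLastRowTwo`). Names suffixed `_two`; no `c * c = 1` hypothesis is needed.

Setting: `G = U(J₂)` (★ `quasiSplit F E c 2`), `G(F) =` ★ `arithmeticSubgroup`, `B(F) =` ★
`arithmeticBorel F E c 2`, `H =` ★ `borelHeight` (`H(g) = h(e₂ g)⁻¹`), and `γ ∈ G(F)` NONE OF WHOSE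
`G(F)`-CONJUGATES LIES IN `B(F)` (`γ` elliptic; no torus classification is used).
* §0 `forall_inv_le_vecHeight_of_forall_borelHeight_le_two` — `H(δ y) ≤ T` for all `δ ∈ G(F)` (`T ≥ 1`)
  forces `h(ξ y) ≥ T⁻¹` for every rational `ξ ≠ 0` (the `N = 2` twin of ★
  `forall_inv_le_vecHeight_of_forall_borelHeight_le`: Godement for anisotropic `ξ`, Witt for isotropic `ξ`).
* §1 `exists_forall_borelHeight_mul_le_of_forall_conj_not_mem_arithmeticBorel_two` (bounded height on
  `Z_γ(𝔸_F)`), `exists_isCompact_forall_exists_mul_mem_centralizer_two` (`Z_γ(𝔸_F) ⊆ G(F) · Kc`, Mahler ★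
  `exists_isCompact_forall_exists_toAdelic_mul_mem`).
* §2 `exists_isCompact_centralizer_subset_mul_of_forall_conj_not_mem_arithmeticBorel_two` —
  `Z_γ(𝔸_F) ⊆ K · (G(F) ∩ Z_γ(𝔸_F))`, `K ⊆ Z_γ(𝔸_F)` compact (★ `finite_setOf_mem_arithmeticSubgroup_of_isCompact`).
* §3 **`compactSpace_centralizer_quotient_of_forall_conj_not_mem_arithmeticBorel_two`** —
  `Z_γ(𝔸_F) ⧸ (A_G G(F) ∩ Z_γ(𝔸_F))` IS COMPACT (letters of ★ `AdelicGroupData.compactSpace_centralizer_quotient`,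
  `A_G = 1` by ★ `quotientSubgroup_quasiSplit`), and the class-map form `…_of_forall_cl_ne_two`
  (★ `forall_conj_not_mem_arithmeticBorel_of_forall_cl_ne`, every `N`).
* §4 **`isMulRightInvariant_centralizer_of_forall_conj_not_mem_arithmeticBorel_two`** (+ class-map form) —
  ELLIPTIC CENTRALISERS OF `U(J₂)` ARE UNIMODULAR (★ `LevelOrbit.isMulRightInvariant_of_compactSpace_quotient`):
  the two-sidedness of the Haar measures on the elliptic centralisers that the orbital unfolding of `J^T_𝔬` binds.

## References

* J. D. Rogawski, *Automorphic Representations of Unitary Groups in Three Variables*, Annals of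
  Mathematics Studies 123 (1990), §2.2–§2.3 (pp. 13–14), §7.3 (p. 98) [Rogawski1990].
* I. M. Gelfand, M. I. Graev, I. I. Piatetski-Shapiro, *Representation Theory and Automorphic
  Functions* (1969), Ch. 1 §2 [GelfandGraevPiatetskiShapiro1969].
* R. Godement, *Domaines fondamentaux des groupes arithmétiques*, Sém. Bourbaki 257 (1962/63), §1.1, §3
  [Godement1964].
* A. Deitmar, S. Echterhoff, *Principles of Harmonic Analysis*, 2nd ed. (2014), Lemma 9.3.3
  [DeitmarEchterhoff2014].
* J. Arthur, *A trace formula for reductive groups I*, Duke Math. J. 45 (1978), §8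
  [Arthur1978TraceFormulaI].
-/

set_option autoImplicit false

noncomputable section

open MeasureTheory NumberField IsDedekindDomain Topology Set Matrix
open Literature.MeasureTheory.Group
open scoped NNReal ENNReal MatrixGroups Pointwise

namespace Literature.NumberTheory.Automorphic

namespace UnitaryGroup

variable {F E : Type} [Field F] [NumberField F] [Field E] [NumberField E] [Algebra F E]
  {c : E ≃ₐ[F] E}

/-! ## §0 Below the cut-off everywhere ⇒ in Mahler's region (`U(J₂)`) -/

/-- **Below the cut-off everywhere ⇒ in the Mahler region** (`U(J₂)`; the `N = 2` twin of ★
`forall_inv_le_vecHeight_of_forall_borelHeight_le`): if no rational translate of `y` has height `> T`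
(`T ≥ 1`), every rational `ξ ≠ 0` of `E²` has `h(ξ y) ≥ T⁻¹` — an anisotropic `ξ` has `h(ξ y) ≥ 1` (Godement,
★ `isotropic_of_vecHeight_vecMul_lt_one`), an isotropic one is `a · e₂ γ` (Witt, ★ `exists_rational_lastRow_eq_smul_two`)
with `h(ξ y) = H(γ y)⁻¹`. [cite: Godement1964, §1.1 and §3] [cite: Rogawski1990, §2.2 (p. 13)] -/
theorem forall_inv_le_vecHeight_of_forall_borelHeight_le_two {T : ℝ≥0} (hT : 1 ≤ T)
    {y : (quasiSplit F E c 2).Adelic}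
    (hy : ∀ γ : (quasiSplit F E c 2).arithmeticSubgroup,
      borelHeight ((γ : (quasiSplit F E c 2).Adelic) * y) ≤ T) :
    ∀ ξ : Fin 2 → E, ξ ≠ 0 →
      T⁻¹ ≤ vecHeight E (principalVec E ξ ᵥ* (adelicVal F E c 2 _ y : Matrix (Fin 2) (Fin 2) (AdeleRing (𝓞 E) E))) := by
  intro ξ hξ
  have hT0 : 0 < T := lt_of_lt_of_le zero_lt_one hT
  by_cases hiso : ∑ i, ξ i * c (ξ (Fin.rev i)) = 0
  · -- isotropic: `ξ = a · e₂ γ`, `h(ξ y) = H(γ y)⁻¹ ≥ T⁻¹`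
    obtain ⟨γ, a, ha, hrow⟩ := exists_rational_lastRow_eq_smul_two (F := F) hξ hiso
    have hlast : lastRow ((quasiSplit F E c 2).toAdelic γ * y) =
        algebraMap E (AdeleRing (𝓞 E) E) a •
          (principalVec E ξ ᵥ* (adelicVal F E c 2 _ y : Matrix (Fin 2) (Fin 2) (AdeleRing (𝓞 E) E))) := by
      rw [lastRow_mul, lastRow_toAdelic, hrow, principalVec_smul_fin, Matrix.smul_vecMul]
    have hfin : IsHeightFinite E
        (principalVec E ξ ᵥ* (adelicVal F E c 2 _ y : Matrix (Fin 2) (Fin 2) (AdeleRing (𝓞 E) E))) :=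
      isHeightFinite_principalVec_vecMul hξ _
    have hH : borelHeight ((quasiSplit F E c 2).toAdelic γ * y) =
        (vecHeight E (principalVec E ξ ᵥ* (adelicVal F E c 2 _ y : Matrix (Fin 2) (Fin 2) (AdeleRing (𝓞 E) E))))⁻¹ := by
      rw [borelHeight_def, hlast]
      exact congrArg _ (vecHeight_smul_algebraMap hfin (Units.mk0 a ha))
    have hle := hy ⟨(quasiSplit F E c 2).toAdelic γ, ⟨γ, rfl⟩⟩
    change borelHeight ((quasiSplit F E c 2).toAdelic γ * y) ≤ T at hle
    rw [hH] at hle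
    -- `h⁻¹ ≤ T ⇒ T⁻¹ ≤ h`
    have hpos : 0 < vecHeight E
        (principalVec E ξ ᵥ* (adelicVal F E c 2 _ y : Matrix (Fin 2) (Fin 2) (AdeleRing (𝓞 E) E))) := by
      have h1 := one_le_matHeightBound_mul_vecHeight (K := E) hξ (adelicVal F E c 2 _ y)
      by_contra h
      rw [not_lt, le_zero_iff] at h
      rw [h, mul_zero] at h1
      exact absurd h1 (not_le.2 zero_lt_one)
    exact (inv_le_comm₀ hpos hT0).1 hle
  · -- anisotropic: `h(ξ y) ≥ 1 ≥ T⁻¹`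
    have h1 : 1 ≤ vecHeight E
        (principalVec E ξ ᵥ* (adelicVal F E c 2 _ y : Matrix (Fin 2) (Fin 2) (AdeleRing (𝓞 E) E))) := by
      by_contra h
      exact hiso (isotropic_of_vecHeight_vecMul_lt_one y (not_le.1 h))
    exact (inv_le_one_of_one_le₀ hT).trans h1

/-! ## §1 Bounded height on an elliptic centraliser; one compact set meets every `G(F)`-orbit on it -/

/-- **Bounded height on the centraliser of an elliptic element of `U(J₂)`**: if no `G(F)`-conjugate of
`γ ∈ G(F)` lies in `B(F)`, there is `c₀ ≥ 1` with `H(δ z) ≤ c₀` for all `z ∈ Z_γ(𝔸_F)`, `δ ∈ G(F)`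
(`(δz)⁻¹ (δγδ⁻¹) (δz) = γ` lies in the compact `{γ}` while `δγδ⁻¹ ∉ B(F)`: Godement's bound ★
`exists_borelHeight_le_of_conj_mem_of_not_mem_arithmeticBorel_two`). [cite: Rogawski1990, §2.2 (p. 13)] -/
theorem exists_forall_borelHeight_mul_le_of_forall_conj_not_mem_arithmeticBorel_two
    {γ : (quasiSplit F E c 2).arithmeticSubgroup}
    (hγ : ∀ δ : (quasiSplit F E c 2).arithmeticSubgroup, δ * γ * δ⁻¹ ∉ arithmeticBorel F E c 2) :
    ∃ c₀ : ℝ≥0, 1 ≤ c₀ ∧ ∀ z : (quasiSplit F E c 2).Adelic,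
      z ∈ Subgroup.centralizer ({(γ : (quasiSplit F E c 2).Adelic)} : Set (quasiSplit F E c 2).Adelic) →
        ∀ δ : (quasiSplit F E c 2).arithmeticSubgroup,
          borelHeight ((δ : (quasiSplit F E c 2).Adelic) * z) ≤ c₀ := by
  obtain ⟨c₀, hc₀⟩ := exists_borelHeight_le_of_conj_mem_of_not_mem_arithmeticBorel_two (c := c)
    (isCompact_singleton (x := ((γ : (quasiSplit F E c 2).Adelic))))
  refine ⟨max 1 c₀, le_max_left _ _, fun z hz δ =>
    (hc₀ _ (δ * γ * δ⁻¹) (hγ δ) ?_).trans (le_max_right _ _)⟩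
  -- `(δ z)⁻¹ (δ γ δ⁻¹) (δ z) = z⁻¹ γ z = γ`
  have hzγ : (γ : (quasiSplit F E c 2).Adelic) * z = z * γ :=
    (Subgroup.mem_centralizer_iff.1 hz) _ (Set.mem_singleton _)
  rw [Set.mem_singleton_iff, Subgroup.coe_mul, Subgroup.coe_mul, Subgroup.coe_inv]
  calc (((δ : (quasiSplit F E c 2).Adelic) * z))⁻¹ *
        ((δ : (quasiSplit F E c 2).Adelic) * γ * (δ : (quasiSplit F E c 2).Adelic)⁻¹) *
          ((δ : (quasiSplit F E c 2).Adelic) * z)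
      = z⁻¹ * ((γ : (quasiSplit F E c 2).Adelic) * z) := by group
    _ = z⁻¹ * (z * γ) := by rw [hzγ]
    _ = γ := by rw [inv_mul_cancel_left]

/-- **One compact set meets every `G(F)`-orbit on an elliptic centraliser of `U(J₂)`**: there is a
compact `Kc ⊆ G(𝔸_F)` such that every `z ∈ Z_γ(𝔸_F)` has a rational translate `δ z ∈ Kc`, `δ ∈ G(F)` —
bounded height of all rational translates (previous lemma) forces `h(ξ z) ≥ c₀⁻¹` for every rational `ξ ≠ 0`
(§0), and Mahler's criterion ★ `exists_isCompact_forall_exists_toAdelic_mul_mem` (every `N`) gives `Kc`.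
[cite: Rogawski1990, §2.2 (p. 13)] -/
theorem exists_isCompact_forall_exists_mul_mem_centralizer_two
    {γ : (quasiSplit F E c 2).arithmeticSubgroup}
    (hγ : ∀ δ : (quasiSplit F E c 2).arithmeticSubgroup, δ * γ * δ⁻¹ ∉ arithmeticBorel F E c 2) :
    ∃ Kc : Set (quasiSplit F E c 2).Adelic, IsCompact Kc ∧ ∀ z : (quasiSplit F E c 2).Adelic,
      z ∈ Subgroup.centralizer ({(γ : (quasiSplit F E c 2).Adelic)} : Set (quasiSplit F E c 2).Adelic) →
        ∃ δ : (quasiSplit F E c 2).arithmeticSubgroup, (δ : (quasiSplit F E c 2).Adelic) * z ∈ Kc := by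
  obtain ⟨c₀, h1, hH⟩ := exists_forall_borelHeight_mul_le_of_forall_conj_not_mem_arithmeticBorel_two hγ
  have hε : 0 < c₀⁻¹ := inv_pos.2 (lt_of_lt_of_le zero_lt_one h1)
  obtain ⟨Kc, hKc, hMah⟩ := exists_isCompact_forall_exists_toAdelic_mul_mem (F := F) (E := E) (c := c) (N := 2) hε
  refine ⟨Kc, hKc, fun z hz => ?_⟩
  obtain ⟨γr, hγr⟩ := hMah z (forall_inv_le_vecHeight_of_forall_borelHeight_le_two h1 (hH z hz))
  exact ⟨⟨(quasiSplit F E c 2).toAdelic γr, MonoidHom.mem_range.2 ⟨γr, rfl⟩⟩, hγr⟩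

/-! ## §2 Set form: `Z_γ(𝔸_F) ⊆ K · Z_γ(F)` with `K ⊆ Z_γ(𝔸_F)` compact -/

/-- **Elliptic centralisers of `U(J₂)` are cocompact modulo their rational points — set form**: if no
`G(F)`-conjugate of `γ ∈ G(F)` lies in `B(F)`, there is a compact `K ⊆ Z_γ(𝔸_F)` with
`Z_γ(𝔸_F) ⊆ K · (G(F) ∩ Z_γ(𝔸_F))` (§1: `δ z⁻¹ = k ∈ Kc`; `δ γ δ⁻¹ = k γ k⁻¹ ∈ G(F) ∩ Kc γ Kc⁻¹`, a FINITE
set by ★ `finite_setOf_mem_arithmeticSubgroup_of_isCompact`; one `p_t ∈ G(F)` per value `t`, `m = p_t⁻¹ δ`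
centralises `γ` and `z = (k⁻¹ p_t) · m` — the lattice lemma with reduction theory supplying the compact set).
[cite: GelfandGraevPiatetskiShapiro1969, Ch. 1 §2] [cite: Rogawski1990, §2.2 (p. 13)] -/
theorem exists_isCompact_centralizer_subset_mul_of_forall_conj_not_mem_arithmeticBorel_two
    {γ : (quasiSplit F E c 2).arithmeticSubgroup}
    (hγ : ∀ δ : (quasiSplit F E c 2).arithmeticSubgroup, δ * γ * δ⁻¹ ∉ arithmeticBorel F E c 2) :
    ∃ K : Set (quasiSplit F E c 2).Adelic, IsCompact K ∧
      K ⊆ Subgroup.centralizer ({(γ : (quasiSplit F E c 2).Adelic)} : Set (quasiSplit F E c 2).Adelic) ∧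
      ((Subgroup.centralizer ({(γ : (quasiSplit F E c 2).Adelic)} : Set (quasiSplit F E c 2).Adelic) :
          Subgroup (quasiSplit F E c 2).Adelic) : Set (quasiSplit F E c 2).Adelic) ⊆
        K * (((quasiSplit F E c 2).arithmeticSubgroup ⊓
          Subgroup.centralizer ({(γ : (quasiSplit F E c 2).Adelic)} : Set (quasiSplit F E c 2).Adelic) :
            Subgroup (quasiSplit F E c 2).Adelic) : Set (quasiSplit F E c 2).Adelic) := by
  classical
  haveI := t2Space_adeleRing_of_numberField E
  haveI : T2Space (quasiSplit F E c 2).Adelic :=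
    inferInstanceAs (T2Space (adelic F E c 2 ((StdForm.antidiagonal 2).over E)))
  obtain ⟨Kc, hKc, hdec⟩ := exists_isCompact_forall_exists_mul_mem_centralizer_two hγ
  set Z : Subgroup (quasiSplit F E c 2).Adelic :=
    Subgroup.centralizer ({(γ : (quasiSplit F E c 2).Adelic)} : Set (quasiSplit F E c 2).Adelic) with hZ
  have hZc : IsClosed (Z : Set (quasiSplit F E c 2).Adelic) :=
    Set.isClosed_centralizer ({(γ : (quasiSplit F E c 2).Adelic)} : Set (quasiSplit F E c 2).Adelic)
  have hmemZ : ∀ g : (quasiSplit F E c 2).Adelic, g ∈ Z ↔ (γ : (quasiSplit F E c 2).Adelic) * g = g * γ :=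
    fun g => by rw [hZ, Subgroup.mem_centralizer_iff]; simp only [Set.mem_singleton_iff, forall_eq]
  -- the compact set `S = Kc γ Kc⁻¹` meets the discrete `G(F)` in a finite set
  set S : Set (quasiSplit F E c 2).Adelic :=
    (fun p : (quasiSplit F E c 2).Adelic × (quasiSplit F E c 2).Adelic =>
      p.1 * (γ : (quasiSplit F E c 2).Adelic) * p.2⁻¹) '' (Kc ×ˢ Kc) with hS
  have hSc : IsCompact S := (hKc.prod hKc).image ((continuous_fst.mul continuous_const).mul continuous_snd.inv)
  have hfin : {t : (quasiSplit F E c 2).arithmeticSubgroup |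
      (1 : (quasiSplit F E c 2).Adelic)⁻¹ * (t : (quasiSplit F E c 2).Adelic) * 1 ∈ S}.Finite :=
    finite_setOf_mem_arithmeticSubgroup_of_isCompact hSc 1 1
  -- one `p_t ∈ G(F)` for every `G(F)`-conjugate `t` of `γ`
  have hpick : ∀ t : (quasiSplit F E c 2).arithmeticSubgroup, ∃ p : (quasiSplit F E c 2).arithmeticSubgroup,
      (∃ δ' : (quasiSplit F E c 2).arithmeticSubgroup, δ' * γ * δ'⁻¹ = t) → p * γ * p⁻¹ = t := by
    intro t
    by_cases h : ∃ δ' : (quasiSplit F E c 2).arithmeticSubgroup, δ' * γ * δ'⁻¹ = t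
    · obtain ⟨δ', h'⟩ := h
      exact ⟨δ', fun _ => h'⟩
    · exact ⟨1, fun h' => absurd h' h⟩
  choose pick hpick using hpick
  set K₀ : Set (quasiSplit F E c 2).Adelic := ⋃ t ∈ hfin.toFinset,
    (fun k : (quasiSplit F E c 2).Adelic => k⁻¹ * ((pick t : (quasiSplit F E c 2).arithmeticSubgroup) :
      (quasiSplit F E c 2).Adelic)) '' Kc with hK₀
  have hK₀c : IsCompact K₀ :=
    hfin.toFinset.isCompact_biUnion fun t _ => hKc.image ((continuous_inv).mul continuous_const)
  refine ⟨K₀ ∩ (Z : Set (quasiSplit F E c 2).Adelic), hK₀c.inter_right hZc, Set.inter_subset_right,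
    fun z hz => ?_⟩
  have hzZ : z ∈ Z := hz
  -- `δ z⁻¹ = k ∈ Kc`
  obtain ⟨δ, hk⟩ := hdec z⁻¹ (Z.inv_mem hzZ)
  set k : (quasiSplit F E c 2).Adelic := (δ : (quasiSplit F E c 2).Adelic) * z⁻¹ with hk_def
  have hzγ : (γ : (quasiSplit F E c 2).Adelic) * z = z * γ := (hmemZ z).1 hzZ
  -- the conjugate `t = δ γ δ⁻¹ = k γ k⁻¹ ∈ S ∩ G(F)`
  set t : (quasiSplit F E c 2).arithmeticSubgroup := δ * γ * δ⁻¹ with ht_def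
  have htk : (t : (quasiSplit F E c 2).Adelic) = k * γ * k⁻¹ := by
    rw [ht_def, Subgroup.coe_mul, Subgroup.coe_mul, Subgroup.coe_inv, hk_def]
    calc (δ : (quasiSplit F E c 2).Adelic) * γ * (δ : (quasiSplit F E c 2).Adelic)⁻¹
        = (δ : (quasiSplit F E c 2).Adelic) * (z⁻¹ * (z * γ)) * z⁻¹ * (z * (δ : (quasiSplit F E c 2).Adelic)⁻¹) := by
          group
      _ = (δ : (quasiSplit F E c 2).Adelic) * (z⁻¹ * ((γ : (quasiSplit F E c 2).Adelic) * z)) * z⁻¹ *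
            (z * (δ : (quasiSplit F E c 2).Adelic)⁻¹) := by rw [hzγ]
      _ = (δ : (quasiSplit F E c 2).Adelic) * z⁻¹ * γ * ((δ : (quasiSplit F E c 2).Adelic) * z⁻¹)⁻¹ := by
          group
  have htS : (t : (quasiSplit F E c 2).Adelic) ∈ S := ⟨(k, k), ⟨hk, hk⟩, htk.symm⟩
  have htT : t ∈ hfin.toFinset := by
    rw [Set.Finite.mem_toFinset, Set.mem_setOf_eq, inv_one, one_mul, mul_one]
    exact htS
  -- the chosen representative `p = p_t` and `m = p⁻¹ δ ∈ Z_γ(F)`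
  set p : (quasiSplit F E c 2).arithmeticSubgroup := pick t with hp_def
  have hpt : p * γ * p⁻¹ = t := hpick t ⟨δ, rfl⟩
  set m : (quasiSplit F E c 2).arithmeticSubgroup := p⁻¹ * δ with hm_def
  have hmγ : m * γ * m⁻¹ = γ := by
    calc m * γ * m⁻¹ = p⁻¹ * (δ * γ * δ⁻¹) * p := by rw [hm_def]; group
      _ = p⁻¹ * (p * γ * p⁻¹) * p := by rw [← ht_def, ← hpt]
      _ = γ := by group
  have hmZ : ((m : (quasiSplit F E c 2).arithmeticSubgroup) : (quasiSplit F E c 2).Adelic) ∈ Z := by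
    rw [hmemZ]
    have h := congrArg (fun x : (quasiSplit F E c 2).arithmeticSubgroup => (x : (quasiSplit F E c 2).Adelic) * m) hmγ
    simp only [Subgroup.coe_mul, Subgroup.coe_inv, inv_mul_cancel_right] at h
    exact h.symm
  -- `z = (k⁻¹ p) · m`
  have hem : k⁻¹ * (p : (quasiSplit F E c 2).Adelic) * m = z := by
    rw [hk_def, hm_def, Subgroup.coe_mul, Subgroup.coe_inv]
    group
  have heZ : k⁻¹ * (p : (quasiSplit F E c 2).Adelic) ∈ Z := by
    have h : k⁻¹ * (p : (quasiSplit F E c 2).Adelic) = z * ((m : (quasiSplit F E c 2).Adelic))⁻¹ := by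
      rw [← hem]; group
    rw [h]
    exact Z.mul_mem hzZ (Z.inv_mem hmZ)
  have heK : k⁻¹ * (p : (quasiSplit F E c 2).Adelic) ∈ K₀ := Set.mem_iUnion₂.2 ⟨t, htT, k, hk, rfl⟩
  exact Set.mem_mul.2 ⟨k⁻¹ * (p : (quasiSplit F E c 2).Adelic), ⟨heK, heZ⟩, m,
    Subgroup.mem_inf.2 ⟨m.2, hmZ⟩, hem⟩

/-! ## §3 `Z_γ(𝔸_F) ⧸ (A_G G(F) ∩ Z_γ(𝔸_F))` is compact for elliptic `γ ∈ U(J₂)(F)` -/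

/-- **ELLIPTIC CENTRALISERS OF `U(J₂)` ARE COCOMPACT** (reduction theory, no torus classification): if no
`G(F)`-conjugate of `γ ∈ G(F)` lies in `B(F)`, then `Z_γ(𝔸_F) ⧸ (A_G · G(F) ∩ Z_γ(𝔸_F))` is compact
(`A_G = 1`, ★ `quotientSubgroup_quasiSplit`) — the letters of ★ `AdelicGroupData.compactSpace_centralizer_quotient`,
the per-class compactness input of the geometric side, for the ELLIPTIC classes of `U(J₂)` (Rogawski (1990),
§2.2–§2.3 and p. 98: the elliptic `𝔬` give `Σ vol(G_γ(F)\G_γ(𝔸)) · Φ(γ, f)` with finite volumes).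
[cite: Rogawski1990, §2.2 (p. 13)] [cite: GelfandGraevPiatetskiShapiro1969, Ch. 1 §2] -/
theorem compactSpace_centralizer_quotient_of_forall_conj_not_mem_arithmeticBorel_two
    {γ : (quasiSplit F E c 2).arithmeticSubgroup}
    (hγ : ∀ δ : (quasiSplit F E c 2).arithmeticSubgroup, δ * γ * δ⁻¹ ∉ arithmeticBorel F E c 2) :
    CompactSpace (↥(Subgroup.centralizer ({(γ : (quasiSplit F E c 2).Adelic)} : Set (quasiSplit F E c 2).Adelic)) ⧸
      ((quasiSplit F E c 2).quotientSubgroup ⊓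
        Subgroup.centralizer ({(γ : (quasiSplit F E c 2).Adelic)} : Set (quasiSplit F E c 2).Adelic)).subgroupOf
          (Subgroup.centralizer ({(γ : (quasiSplit F E c 2).Adelic)} : Set (quasiSplit F E c 2).Adelic))) := by
  haveI := t2Space_adeleRing_of_numberField E
  haveI : T2Space (quasiSplit F E c 2).Adelic :=
    inferInstanceAs (T2Space (adelic F E c 2 ((StdForm.antidiagonal 2).over E)))
  obtain ⟨K, hK, hKZ, hZK⟩ := exists_isCompact_centralizer_subset_mul_of_forall_conj_not_mem_arithmeticBorel_two hγ
  rw [quotientSubgroup_quasiSplit (F := F) (E := E) (c := c) (N := 2)]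
  exact compactSpace_quotient_subgroupOf_of_subset_mul
    ((quasiSplit F E c 2).arithmeticSubgroup ⊓
      Subgroup.centralizer ({(γ : (quasiSplit F E c 2).Adelic)} : Set (quasiSplit F E c 2).Adelic))
    (Subgroup.centralizer ({(γ : (quasiSplit F E c 2).Adelic)} : Set (quasiSplit F E c 2).Adelic))
    (Set.isClosed_centralizer ({(γ : (quasiSplit F E c 2).Adelic)} : Set (quasiSplit F E c 2).Adelic))
    hK hKZ hZK

/-- **ELLIPTIC CENTRALISERS OF `U(J₂)` ARE COCOMPACT — class-map form**: for a conjugation-invariant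
class map `cl` on `G(F)` (★ `IsConjInvariant`), a class `i` missing `B(F)` (the hypothesis shape of ★
`truncatedKernelClass_eq_kernelClass_of_forall_ne`) and any `γ` of class `i`,
`Z_γ(𝔸_F) ⧸ (A_G · G(F) ∩ Z_γ(𝔸_F))` is compact (the per-class `CompactSpace` binder of the elliptic
unfolding, at `γ := rep s`; ★ `forall_conj_not_mem_arithmeticBorel_of_forall_cl_ne`).
[cite: Rogawski1990, §2.2 (p. 13)] -/
theorem compactSpace_centralizer_quotient_of_forall_cl_ne_two {ι : Type*}
    {cl : (quasiSplit F E c 2).arithmeticSubgroup → ι} (hcl : IsConjInvariant cl) {i : ι}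
    (hi : ∀ β : arithmeticBorel F E c 2, cl β ≠ i) {γ : (quasiSplit F E c 2).arithmeticSubgroup}
    (hγi : cl γ = i) :
    CompactSpace (↥(Subgroup.centralizer ({(γ : (quasiSplit F E c 2).Adelic)} : Set (quasiSplit F E c 2).Adelic)) ⧸
      ((quasiSplit F E c 2).quotientSubgroup ⊓
        Subgroup.centralizer ({(γ : (quasiSplit F E c 2).Adelic)} : Set (quasiSplit F E c 2).Adelic)).subgroupOf
          (Subgroup.centralizer ({(γ : (quasiSplit F E c 2).Adelic)} : Set (quasiSplit F E c 2).Adelic))) :=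
  compactSpace_centralizer_quotient_of_forall_conj_not_mem_arithmeticBorel_two
    (forall_conj_not_mem_arithmeticBorel_of_forall_cl_ne hcl hi hγi)

/-! ## §4 Elliptic centralisers of `U(J₂)` are unimodular -/

section Unimodular

variable [MeasurableSpace (quasiSplit F E c 2).Adelic] [BorelSpace (quasiSplit F E c 2).Adelic]

/-- **ELLIPTIC CENTRALISERS OF `U(J₂)` ARE UNIMODULAR**: if no `G(F)`-conjugate of `γ ∈ G(F)` lies in
`B(F)`, every Haar measure of `Z_γ(𝔸_F) = C_{G(𝔸_F)}(γ)` is right invariant — `Z_γ(F) = G(F) ∩ Z_γ(𝔸_F)`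
is a discrete (★ `isDiscreteRational_quasiSplit`) cocompact (§3) subgroup of a locally compact second
countable group (★ `LevelOrbit.isMulRightInvariant_of_compactSpace_quotient`; Deitmar–Echterhoff (2014),
Lemma 9.3.3 «the centralizer `G_γ` is unimodular»): the two-sidedness of the Haar measure `νC` of `Z_γ(𝔸_F)`
under which the Weil quotient measure on `G(𝔸_F) ⧸ Z_γ(𝔸_F)` carrying the orbital integral at `γ` exists.
[cite: DeitmarEchterhoff2014, Lemma 9.3.3] [cite: Rogawski1990, §2.2 (p. 13)] -/
theorem isMulRightInvariant_centralizer_of_forall_conj_not_mem_arithmeticBorel_two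
    {γ : (quasiSplit F E c 2).arithmeticSubgroup}
    (hγ : ∀ δ : (quasiSplit F E c 2).arithmeticSubgroup, δ * γ * δ⁻¹ ∉ arithmeticBorel F E c 2)
    (νZ : Measure ↥(Subgroup.centralizer ({(γ : (quasiSplit F E c 2).Adelic)} : Set (quasiSplit F E c 2).Adelic)))
    [νZ.IsHaarMeasure] : νZ.IsMulRightInvariant := by
  -- topology of `G = U(J₂)(𝔸_F)`
  haveI := secondCountableTopology_adeleRing E
  haveI := locallyCompactSpace_adeleRing' E
  haveI := t2Space_adeleRing_of_numberField E
  haveI : T2Space (quasiSplit F E c 2).Adelic :=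
    inferInstanceAs (T2Space (adelic F E c 2 ((StdForm.antidiagonal 2).over E)))
  haveI : LocallyCompactSpace (quasiSplit F E c 2).Adelic :=
    inferInstanceAs (LocallyCompactSpace (adelic F E c 2 ((StdForm.antidiagonal 2).over E)))
  haveI : SecondCountableTopology (quasiSplit F E c 2).Adelic :=
    inferInstanceAs (SecondCountableTopology (adelic F E c 2 ((StdForm.antidiagonal 2).over E)))
  have hZc : IsClosed ((Subgroup.centralizer ({(γ : (quasiSplit F E c 2).Adelic)} :
      Set (quasiSplit F E c 2).Adelic)) : Set (quasiSplit F E c 2).Adelic) :=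
    Set.isClosed_centralizer ({(γ : (quasiSplit F E c 2).Adelic)} : Set (quasiSplit F E c 2).Adelic)
  haveI : LocallyCompactSpace ↥(Subgroup.centralizer ({(γ : (quasiSplit F E c 2).Adelic)} :
      Set (quasiSplit F E c 2).Adelic)) := hZc.isClosedEmbedding_subtypeVal.locallyCompactSpace
  haveI : SecondCountableTopology ↥(Subgroup.centralizer ({(γ : (quasiSplit F E c 2).Adelic)} :
      Set (quasiSplit F E c 2).Adelic)) := TopologicalSpace.Subtype.secondCountableTopology _
  -- the subgroup `Z_γ(F) = A_G G(F) ∩ Z_γ(𝔸_F)` of `Z_γ(𝔸_F)` is discrete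
  haveI : DiscreteTopology ↥(quasiSplit F E c 2).arithmeticSubgroup := isDiscreteRational_quasiSplit
  have hmemΛ : ∀ x : ↥(Subgroup.centralizer ({(γ : (quasiSplit F E c 2).Adelic)} :
      Set (quasiSplit F E c 2).Adelic)),
      x ∈ ((quasiSplit F E c 2).quotientSubgroup ⊓ (Subgroup.centralizer ({(γ : (quasiSplit F E c 2).Adelic)} :
        Set (quasiSplit F E c 2).Adelic))).subgroupOf (Subgroup.centralizer ({(γ : (quasiSplit F E c 2).Adelic)} :
          Set (quasiSplit F E c 2).Adelic)) →
      (x : (quasiSplit F E c 2).Adelic) ∈ (quasiSplit F E c 2).arithmeticSubgroup := fun x hx => by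
    have h := (Subgroup.mem_inf.1 (Subgroup.mem_subgroupOf.1 hx)).1
    rwa [quotientSubgroup_quasiSplit] at h
  haveI : DiscreteTopology ↥(((quasiSplit F E c 2).quotientSubgroup ⊓
      (Subgroup.centralizer ({(γ : (quasiSplit F E c 2).Adelic)} : Set (quasiSplit F E c 2).Adelic))).subgroupOf
        (Subgroup.centralizer ({(γ : (quasiSplit F E c 2).Adelic)} : Set (quasiSplit F E c 2).Adelic))) := by
    refine DiscreteTopology.of_continuous_injective
      (f := fun x => (⟨((x : ↥(Subgroup.centralizer ({(γ : (quasiSplit F E c 2).Adelic)} :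
          Set (quasiSplit F E c 2).Adelic))) : (quasiSplit F E c 2).Adelic), hmemΛ x x.2⟩ :
        ↥(quasiSplit F E c 2).arithmeticSubgroup)) ?_ ?_
    · exact (continuous_subtype_val.comp continuous_subtype_val).subtype_mk _
    · intro a b hab
      have h : (((a : ↥(Subgroup.centralizer ({(γ : (quasiSplit F E c 2).Adelic)} :
          Set (quasiSplit F E c 2).Adelic)))) : (quasiSplit F E c 2).Adelic) =
          (((b : ↥(Subgroup.centralizer ({(γ : (quasiSplit F E c 2).Adelic)} :
            Set (quasiSplit F E c 2).Adelic)))) : (quasiSplit F E c 2).Adelic) :=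
        congrArg (fun y : ↥(quasiSplit F E c 2).arithmeticSubgroup => (y : (quasiSplit F E c 2).Adelic)) hab
      exact Subtype.ext (Subtype.ext h)
  -- and cocompact (§3)
  haveI := compactSpace_centralizer_quotient_of_forall_conj_not_mem_arithmeticBorel_two hγ
  exact LevelOrbit.isMulRightInvariant_of_compactSpace_quotient
    (((quasiSplit F E c 2).quotientSubgroup ⊓ (Subgroup.centralizer ({(γ : (quasiSplit F E c 2).Adelic)} :
      Set (quasiSplit F E c 2).Adelic))).subgroupOf (Subgroup.centralizer ({(γ : (quasiSplit F E c 2).Adelic)} :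
        Set (quasiSplit F E c 2).Adelic))) νZ

/-- **ELLIPTIC CENTRALISERS OF `U(J₂)` ARE UNIMODULAR — class-map form**: for a conjugation-invariant
class map `cl`, a class `i` missing `B(F)` and `γ` of class `i`, every Haar measure of `Z_γ(𝔸_F)` is right
invariant (the two-sidedness of `νC s` at `γ := rep s` in the orbital unfolding of `J^T_𝔬`).
[cite: DeitmarEchterhoff2014, Lemma 9.3.3] [cite: Rogawski1990, §2.2 (p. 13)] -/
theorem isMulRightInvariant_centralizer_of_forall_cl_ne_two {ι : Type*}
    {cl : (quasiSplit F E c 2).arithmeticSubgroup → ι} (hcl : IsConjInvariant cl) {i : ι}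
    (hi : ∀ β : arithmeticBorel F E c 2, cl β ≠ i) {γ : (quasiSplit F E c 2).arithmeticSubgroup}
    (hγi : cl γ = i) (νZ : Measure ↥(Subgroup.centralizer ({(γ : (quasiSplit F E c 2).Adelic)} :
      Set (quasiSplit F E c 2).Adelic))) [νZ.IsHaarMeasure] : νZ.IsMulRightInvariant :=
  isMulRightInvariant_centralizer_of_forall_conj_not_mem_arithmeticBorel_two
    (forall_conj_not_mem_arithmeticBorel_of_forall_cl_ne hcl hi hγi) νZ

end Unimodular

end UnitaryGroup

end Literature.NumberTheory.Automorphic
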